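import Literature.MathematicalPhysics.QuantumLattice.HubbardTorusTTPrimeClusterEnergyRepresentative
import Literature.MathematicalPhysics.QuantumLattice.HubbardNNNHoppingThermodynamicLimit
import Literature.MathematicalPhysics.QuantumLattice.HubbardNNNHoppingClusterEmbedding
import Literature.MathematicalPhysics.QuantumLattice.BootstrapCertificateDuality
import Summits.Ventures.CertifiedManyBodySolver.HubbardAlg.SdaClusterWitness
import Summits.Ventures.CertifiedManyBodySolver.Statement
import HarnessLib
import HarnessLib.Audit

/-!
# SDA by-name weighted-cluster witnesses — part 3: the `t–t'` model (`t' ≠ 0`).  The PROVED edge "certified `t–t'` weighted open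
# cluster (nearest-neighbour AND diagonal bond weights, interaction weights, free site potentials) ⇒ floor on `energyDensityTT'`"
# (every `t, t'`, `U ≥ 0`, `0 ≤ n < 2`), rectangles in coordinates, the seven-parameter `D₄ × spin`-symmetric `3 × 3` class, the
# `M3EnergyLowerRow t'` link and the frozen-weight family

hubbard-algo crew (5), seat hubbard-algo-p3 "few-parameter dual ansätze" (D-0042 R2(e); HOME `run/shared/lean/pub/hubbard-algo/`,
`hubbard-algo-p3/TARGET.md` §8 WANTED-7 (i′) "by-name SDA floors at `t' ≠ 0`": until this file nothing of the seat's witness programme was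
by-name at `t' ≠ 0`, because the weighted-cluster tree theorem `AndersonCluster.energyDensity2D_ge_of_clusterFamily` and parts 1/2
(`SdaClusterWitness.lean` p473256, `SdaClusterWitnessU4U12.lean`) are nearest-neighbour Hubbard only, while the tree's `t'` cluster floors
(`HubbardNNNHoppingClusterLowerBound`: `groundEnergy_hubbardRectTorusTT'_ge_of_openBox_*`) are UNIFORM boxes).
HONEST FRAMING: first certified bounds; not a superconductivity verdict; every number certified-of-record or labelled FLOAT.  A `3 × 3`
instance of this class at the cuprate point `(U, n, t') = (8, 7/8, -1/4)` reads `≈ -1.0` (FLOAT forecast) and is DOMINATED by the tree's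
row #504 (`-0.8341460554`, `Certificates/HubbardSquare_n7o8_lower_row504.lean`): the class is landed as the BY-NAME WITNESS SHAPE of the
programme at `t' ≠ 0` (a thermodynamic-limit floor carried by eleven printed rationals and ONE finite positive-semidefiniteness claim),
not as an anchor; instances follow in a separate part with their kit-VERIFIED certificates, exactly as parts 1/2 did at `t' = 0`.

## What is here (everything PROVED; no `sorry`, no new axiom, no Literature fact minted)

* §1 **finite tori** `groundEnergy_torusTT'_ge_of_cluster`: on `(ℤ/Lℤ)²`, `L ≥ 3`, for a window `Λ` fitting into the torus, normalised
  weights — nearest-neighbour `Σ_x J̃(x,i) = 1` per lattice direction `i`, DIAGONAL `Σ_x J̃'(x,s) = 1` per diagonal type `s`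
  (`diagBondWeightSum`, `HubbardTorusTTPrimeClusterEnergyRepresentative.lean`), interaction `Σ V = 1` — and free potentials `μ'`:
  `h^{tt'}(Λ) - m ⪰ 0 ⇒ L² m - (Σμ') N ≤ E₀(H^{tt'}_L, N)` for every `N ≤ 2L²`.  One line of bookkeeping on top of the Literature
  identity `Σ_v T_v Γ(h^{tt'}) T_v⁻¹ = H^{tt'}_L - μ N_L` (`sum_relabel_translate_clusterHamiltonianTT'_eq`, written for the thermal
  Markov-pressure chain and until now without a `T = 0` consumer), positivity transport through `fermionEmbed` / `relabel`
  (`HubbardNNNHoppingClusterEmbedding`) and the sector duality lemma `le_groundEnergy_of_posSemidef_sub_sector`.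
* §2 **the EDGE** `energyDensityTT'_ge_of_cluster`: `m - (Σ_x μ' x)·n ≤ energyDensityTT' t t' U n` (`U ≥ 0`, `0 ≤ n < 2`) along the
  defining tori (`energyDensityTT'_ge_of_eventually_ge_torus`, `exists_forall_le_injOn_proj`); consistency `clusterHamiltonianTT'_zero` /
  `energyDensity2D_ge_of_cluster_tPrime_zero` (at `t' = 0` the diagonal term vanishes and the edge is g4's, read through `energyDensityTT'_zero`).
* §3 **rectangles in coordinates** `energyDensityTT'_ge_of_clusterRect` with the diagonal coordinate lemmas `diagBondWeightSum_rect_zero/one`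
  (type `0` = bond `(c,r) → (c+1,r+1)`, type `1` = bond `(c,r) → (c+1,r-1)`, indexed by the left endpoint; the nearest-neighbour / site
  lemmas `bondWeightSum_rect_zero'/one'`, `siteWeightSum_rect'` of `Rows.RectMarginalNodesAnderson` are CITED).
* §4 **the seven-parameter class** on the open `3 × 3` window: g4's `D₄` tables `w3 jb jc` (8 boundary bonds `jb`, 4 centre bonds `jc`;
  `4jb + 2jc = 1`) and `s3` (corner / edge / centre interaction weights `4vc + 4ve + vm = 1` and potentials `pc, pe, pm`) plus the new
  DIAGONAL table `d3 jd je` (the 4 diagonal bonds through the centre carry `jd`, the 4 edge-midpoint–edge-midpoint diagonals `je`;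
  `2jd + 2je = 1` per type): `energyDensityTT'_ge_of_sdaD4Floor33TT' : 4jb+2jc = 1 → 2jd+2je = 1 → 4vc+4ve+vm = 1 →
  SdaD4Floor33TT' t t' U … m → m - (4pc+4pe+pm) n ≤ e(t,t',U,n)`, and the venture link `m3EnergyLowerRow_of_sdaD4Floor33TT'`
  (`(t,U,n) = (1,8,7/8)`, ANY `t'`: the cell predicate `M3EnergyLowerRow t' lo` of `Statement.lean` §M3).
* §5 **frozen-weight family** `energyDensityTT'_ge_frozen33`: `(J, V)` frozen at g4's `(8, 7/8, 0)` optimum `(Jb, Jc, Vc, Ve, Vm)` and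
  UNIFORM diagonal weights `1/4` — the sub-class the engine token `TA` produces at `t' ≠ 0` (uniform diagonal representative, free
  nearest-neighbour / density transfers); the full class (free `jd, je`) is the engine token `TD` (sda v1.3e).

NOT here (stands as WANTED-7 (i″) in TARGET.md): the general one-body-table class (sda token `TU`: arbitrary finite-range hopping tables `K`
with prescribed displacement-class sums, i.e. longer-range one-body TI transfers) — the Literature translate identity is per bond FAMILY
(nearest-neighbour directions, diagonal types), not per displacement class; and the `t' ≠ 0` twins of the window-node soundness chain
(`SdaDualEdge*.lean`: EOM / symmetry rows), whose primal `LTIRect*Node*` is nearest-neighbour only.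

Nothing in this file asserts a bound unconditionally: `theorem … (hm : <PSD claim>) : …`.  No instance is exported (one section-local
decidability instance, the tree's own convention for torus files), no notation, no attribute removal (typer lint).
Sources: [cite: Anderson1951, eq. (2)] (cluster decomposition), [cite: ValentiStolzeHirschfeld1991, §II] (weighted clusters with chemical
potentials), [cite: XuEtAl2024, eq. (1)] (the `t–t'–U` Hamiltonian), [cite: Ruelle1969, §3.3] (the thermodynamic limit).
-/

noncomputable section

open Matrix Complex Finset Filter
open scoped ComplexOrder MatrixOrder BigOperators Topology
open Literature.Probability.LatticeModels
open Literature.MathematicalPhysics.QuantumLattice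
open Literature.MathematicalPhysics.QuantumLattice.AndersonCluster
open Literature.MathematicalPhysics.QuantumLattice.HubbardWave0
open Literature.MathematicalPhysics.QuantumLattice.ThermodynamicLimit
open Summit.Ventures.CertifiedManyBodySolver.Rows.RectMarginalNodes
open Summit.Ventures.CertifiedManyBodySolver.HubbardAlg.SdaClusterWitness

namespace Summit.Ventures.CertifiedManyBodySolver.HubbardAlg.SdaClusterWitnessTT

/-! ## §1  Finite tori: the translates of a certified `t–t'` weighted cluster bound every sector ground energy -/

section Torus

variable {L : ℕ} [NeZero L]

/-- (Local, exactly as in the Literature files `HubbardAndersonClusterBound` / `HubbardTorusTTPrimeClusterEnergyRepresentative`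
and the venture's `HubbardAlg/GSWindowNodeD4Sound`: torus-site equality decided through the linear order, the instance the
tree's translate / embedding lemmas were elaborated with.) -/
local instance (priority := high) instDecidableEqFermionTorusSdaTT : DecidableEq (FermionTorus 2 L) :=
  LinearOrder.toDecidableEq

/-- **`t–t'` weighted cluster ⇒ torus sector floors.**  On the square torus `(ℤ/Lℤ)²`, `L ≥ 3`, a window `Λ ⊆ ℤ²` on which
`x ↦ x mod L` is injective, NORMALISED nearest-neighbour bond weights `J` (`Σ = 1` per lattice direction), diagonal bond weights
`J'` (`Σ = 1` per diagonal type), interaction weights `V` (`Σ = 1`) and FREE site potentials `μ'`: a certified floor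
`h^{tt'}(Λ; J, J', V, μ') ⪰ m` on the cluster Fock space gives, in every sector `N ≤ 2L²`,
`L²·m - (Σ μ')·N ≤ E₀(H^{tt'}_L, N)` — because `Σ_v T_v Γ(h - m) T_v⁻¹ = H^{tt'}_L + (Σμ') N̂ - L² m ⪰ 0`
(`sum_relabel_translate_clusterHamiltonianTT'_eq`). [cite: Anderson1951, eq. (2)] [cite: ValentiStolzeHirschfeld1991, §II] -/
theorem groundEnergy_torusTT'_ge_of_cluster (t t' U : ℝ) (hL : 3 ≤ L) (Λ : Finset (Site 2))
    (hT : Set.InjOn (Torus.proj (d := 2) L) ↑Λ) (J J' : Site 2 → Fin 2 → ℝ) (V μ' : Site 2 → ℝ) {m : ℝ}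
    (hJ : ∀ i, bondWeightSum Λ J i = 1) (hJ' : ∀ s, diagBondWeightSum Λ J' s = 1) (hV : siteWeightSum Λ V = 1)
    (hm : (clusterHamiltonianTT' Λ t t' U J J' V μ' - ((m : ℝ) : ℂ) • (1 : FermionOp Λ)).PosSemidef)
    {N : ℕ} (hN : N ≤ 2 * L ^ 2) :
    (L : ℝ) ^ 2 * m - siteWeightSum Λ μ' * N ≤ groundEnergy (hubbardTorusTT' L t t' U) N := by
  set M : ℝ := siteWeightSum Λ μ' with hM
  set X : TorusSite 2 L → Matrix (Finset (Orb (FermionTorus 2 L))) (Finset (Orb (FermionTorus 2 L))) ℂ :=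
    fun v => relabel (Orb.translate v) (fermionEmbed (PolySite.toTorusEmb L hT) (clusterHamiltonianTT' Λ t t' U J J' V μ'))
    with hX
  -- each translate of the shifted cluster is positive
  have hpos : ∀ v, (X v - ((m : ℝ) : ℂ) •
      (1 : Matrix (Finset (Orb (FermionTorus 2 L))) (Finset (Orb (FermionTorus 2 L))) ℂ)).PosSemidef := by
    intro v
    have h1 := posSemidef_relabel (Orb.translate v) (posSemidef_fermionEmbed_sub_smul_one (PolySite.toTorusEmb L hT) hm)
    rwa [relabel_sub, relabel_smul, map_one] at h1
  have hP : (∑ v, (X v - ((m : ℝ) : ℂ) •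
      (1 : Matrix (Finset (Orb (FermionTorus 2 L))) (Finset (Orb (FermionTorus 2 L))) ℂ))).PosSemidef :=
    Matrix.posSemidef_sum _ fun v _ => hpos v
  -- the sum of all translates is `H^{tt'} - (-M) N̂`
  have hsum : ∑ v, X v = hubbardTorusTT' L t t' U - (((-M : ℝ)) : ℂ) •
      (totalNumber : Matrix (Finset (Orb (FermionTorus 2 L))) (Finset (Orb (FermionTorus 2 L))) ℂ) :=
    sum_relabel_translate_clusterHamiltonianTT'_eq hL hT t t' U (-M) hJ hJ' hV (by rw [neg_neg])
  have hcard : (Finset.univ : Finset (TorusSite 2 L)).card = L ^ 2 := by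
    rw [Finset.card_univ]; simp [ZMod.card, Fintype.card_fin]
  have hPeq : ∑ v, (X v - ((m : ℝ) : ℂ) •
      (1 : Matrix (Finset (Orb (FermionTorus 2 L))) (Finset (Orb (FermionTorus 2 L))) ℂ)) =
      hubbardTorusTT' L t t' U + (M : ℂ) • totalNumber - (((L : ℝ) ^ 2 * m : ℝ) : ℂ) • 1 := by
    rw [Finset.sum_sub_distrib, Finset.sum_const, hcard, hsum, ← Nat.cast_smul_eq_nsmul ℂ, smul_smul]
    push_cast
    module
  rw [hPeq] at hP
  have hN' : N ≤ Fintype.card (Orb (FermionTorus 2 L)) := by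
    rw [card_orb, Fintype.card_lex, Fintype.card_fun, Fintype.card_fin, Fintype.card_fin]; exact hN
  exact le_groundEnergy_of_posSemidef_sub_sector hN'
    (H := hubbardTorusTT' L t t' U) (c := (L : ℝ) ^ 2 * m - M * N)
    (K := (-(M : ℂ)) • ((totalNumber : Matrix (Finset (Orb (FermionTorus 2 L))) _ ℂ) - (N : ℂ) • 1))
    (fun ψ hψ => by
      rw [smul_mulVec, sub_mulVec, totalNumber_mulVec_of_isNParticle hψ, smul_mulVec, one_mulVec,
        sub_self, smul_zero, dotProduct_zero])
    (by
      convert hP using 1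
      push_cast
      module)

end Torus

/-! ## §2  The PROVED edge: `t–t'` weighted cluster ⇒ thermodynamic-limit floor (all `t, t'`, `U ≥ 0`, `0 ≤ n < 2`) -/

/-- **EDGE (`t–t'` SDA weighted cluster ⇒ `energyDensityTT'`).**  For ANY finite window `Λ ⊆ ℤ²`, normalised weights
`(J, J', V)` and free potentials `μ'`, a certified cluster floor `h^{tt'}(Λ; t, t', U, J, J', V, μ') ⪰ m` gives
`m - (Σ_x μ' x)·n ≤ e(t, t', U, n)` (`energyDensityTT'`; `U ≥ 0`, `0 ≤ n < 2`): the torus floors of §1 along `L → ∞`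
(`energyDensityTT'_ge_of_eventually_ge_torus`, `exists_forall_le_injOn_proj`).  At `t' = 0` this is the tree's
`AndersonCluster.energyDensity2D_ge_of_clusterFamily` (`κ = Unit`); the diagonal weights `J'` are the new freedom.
[cite: Anderson1951, eq. (2)] [cite: ValentiStolzeHirschfeld1991, §II] [cite: Ruelle1969, §3.3] -/
theorem energyDensityTT'_ge_of_cluster (t t' : ℝ) {U : ℝ} (hU : 0 ≤ U) {n : ℝ} (hn0 : 0 ≤ n) (hn2 : n < 2)
    (Λ : Finset (Site 2)) (J J' : Site 2 → Fin 2 → ℝ) (V μ' : Site 2 → ℝ) {m : ℝ}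
    (hJ : ∀ i, bondWeightSum Λ J i = 1) (hJ' : ∀ s, diagBondWeightSum Λ J' s = 1) (hV : siteWeightSum Λ V = 1)
    (hm : (clusterHamiltonianTT' Λ t t' U J J' V μ' - ((m : ℝ) : ℂ) • (1 : FermionOp Λ)).PosSemidef) :
    m - siteWeightSum Λ μ' * n ≤ energyDensityTT' t t' U n := by
  obtain ⟨L₁, hL₁⟩ := exists_forall_le_injOn_proj Λ
  set M : ℝ := siteWeightSum Λ μ' with hM
  refine energyDensityTT'_ge_of_eventually_ge_torus t t' hU hn0 hn2 (c := m - M * n) (μ := -M) ?_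
  filter_upwards [eventually_ge_atTop (max 3 L₁)] with L hL
  have hL3 : 3 ≤ L := le_trans (le_max_left _ _) hL
  haveI : NeZero L := ⟨by omega⟩
  have hT : Set.InjOn (Torus.proj (d := 2) L) ↑Λ := hL₁ L (le_trans (le_max_right _ _) hL)
  have h := groundEnergy_torusTT'_ge_of_cluster t t' U hL3 Λ hT J J' V μ' hJ hJ' hV hm (N := rectN n L)
    (by have := rectN_le_two_mul hn0 hn2.le L; rw [sq]; exact this)
  have hLpos : (0 : ℝ) < (L : ℝ) ^ 2 := by
    have : (0 : ℝ) < L := by exact_mod_cast (show 0 < L by omega)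
    positivity
  rw [le_div_iff₀ hLpos]
  have hre : (m - M * n + -M * ((rectN n L : ℝ) / (L : ℝ) ^ 2 - n)) * (L : ℝ) ^ 2 =
      (L : ℝ) ^ 2 * m - M * (rectN n L : ℕ) := by
    field_simp
    ring
  rw [hre]
  exact h

/-- **Consistency at `t' = 0`**: the diagonal term vanishes (`clusterDiagTerm Λ 0 J' = 0`), so the `t–t'` cluster IS the tree's
weighted cluster and the edge reads on `energyDensity2D` (`energyDensityTT'_zero`) — g4's `tiStateNode_of_clusterHamiltonian` composed
with the transport, for any auxiliary normalised `J'`. -/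
theorem clusterHamiltonianTT'_zero (Λ : Finset (Site 2)) (t U : ℝ) (J J' : Site 2 → Fin 2 → ℝ) (V μ' : Site 2 → ℝ) :
    clusterHamiltonianTT' Λ t 0 U J J' V μ' = clusterHamiltonian Λ t U J V μ' := by
  simp [clusterHamiltonianTT', clusterDiagTerm]


/-- … so at `t' = 0` the edge bounds `energyDensity2D` (any auxiliary normalised diagonal table `J'`). -/
theorem energyDensity2D_ge_of_cluster_tPrime_zero (t : ℝ) {U : ℝ} (hU : 0 ≤ U) {n : ℝ} (hn0 : 0 ≤ n) (hn2 : n < 2)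
    (Λ : Finset (Site 2)) (J J' : Site 2 → Fin 2 → ℝ) (V μ' : Site 2 → ℝ) {m : ℝ}
    (hJ : ∀ i, bondWeightSum Λ J i = 1) (hJ' : ∀ s, diagBondWeightSum Λ J' s = 1) (hV : siteWeightSum Λ V = 1)
    (hm : (clusterHamiltonian Λ t U J V μ' - ((m : ℝ) : ℂ) • (1 : FermionOp Λ)).PosSemidef) :
    m - siteWeightSum Λ μ' * n ≤ energyDensity2D t U n := by
  rw [← energyDensityTT'_zero]
  exact energyDensityTT'_ge_of_cluster t 0 hU hn0 hn2 Λ J J' V μ' hJ hJ' hV (by rwa [clusterHamiltonianTT'_zero])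

/-! ## §3  Rectangles in coordinates (the shape certificate tables are printed in) -/

/-- `Σ_{k<b} [1 ≤ k] f k = Σ_{k<b-1} f (k+1)`. -/
theorem sum_range_ite_one_le (b : ℕ) (f : ℕ → ℝ) :
    ∑ k ∈ Finset.range b, (if 1 ≤ k then f k else 0) = ∑ k ∈ Finset.range (b - 1), f (k + 1) := by
  cases b with
  | zero => simp
  | succ n =>
    rw [Finset.sum_range_succ', if_neg (by omega), add_zero, Nat.add_sub_cancel]
    exact Finset.sum_congr rfl fun j _ => by rw [if_pos (by omega)]

/-- Diagonal bonds of type `0` (`(c, r) → (c+1, r+1)`) of the rectangle `[0,a) × [0,b)`: weight sum `Σ_{c<a-1} Σ_{r<b-1} w c r 0`. -/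
theorem diagBondWeightSum_rect_zero (a b : ℕ) (w : ℕ → ℕ → Fin 2 → ℝ) :
    diagBondWeightSum (rectWindow a b) (rectBondWeights w) 0 =
      ∑ c ∈ Finset.range (a - 1), ∑ r ∈ Finset.range (b - 1), w c r 0 := by
  rw [diagBondWeightSum, sum_rectWindow_eq']
  have h1 : ∀ c ∈ Finset.range a, ∀ r ∈ Finset.range b,
      diagBondWeight (rectWindow a b) (rectBondWeights w) (mkSite2 c r) 0 =
        if c + 1 < a ∧ r + 1 < b then w c r 0 else 0 := by
    intro c hc r hr
    have hc' := Finset.mem_range.1 hc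
    have hr' := Finset.mem_range.1 hr
    have hiff : mkSite2 c r + diagVec 0 ∈ rectWindow a b ↔ c + 1 < a ∧ r + 1 < b := by
      rw [mem_rectWindow']
      simp only [Pi.add_apply, diagVec_apply_zero, diagVec_apply_one, if_true, mkSite2_zero', mkSite2_one']
      omega
    simp only [diagBondWeight, rectBondWeights, mkSite2_zero', mkSite2_one', Int.toNat_natCast]
    by_cases h : c + 1 < a ∧ r + 1 < b
    · rw [if_pos (hiff.2 h), if_pos h]
    · rw [if_neg (fun h' => h (hiff.1 h')), if_neg h]
  rw [Finset.sum_congr rfl fun c hc => Finset.sum_congr rfl fun r hr => h1 c hc r hr]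
  rw [← sum_range_ite_succ_lt' a (fun c => ∑ r ∈ Finset.range (b - 1), w c r 0)]
  refine Finset.sum_congr rfl fun c _ => ?_
  rw [← sum_range_ite_succ_lt' b (fun r => w c r 0)]
  by_cases hc : c + 1 < a
  · rw [if_pos hc]
    exact Finset.sum_congr rfl fun r _ => by by_cases hr : r + 1 < b <;> simp [hc, hr]
  · rw [if_neg hc]
    exact Finset.sum_eq_zero fun r _ => by simp [hc]

/-- Diagonal bonds of type `1` (`(c, r+1) → (c+1, r)`) of the rectangle `[0,a) × [0,b)`: weight sum `Σ_{c<a-1} Σ_{r<b-1} w c (r+1) 1`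
(the bond is indexed by its LEFT endpoint `(c, r+1)`, as in `diagBondWeight`). -/
theorem diagBondWeightSum_rect_one (a b : ℕ) (w : ℕ → ℕ → Fin 2 → ℝ) :
    diagBondWeightSum (rectWindow a b) (rectBondWeights w) 1 =
      ∑ c ∈ Finset.range (a - 1), ∑ r ∈ Finset.range (b - 1), w c (r + 1) 1 := by
  rw [diagBondWeightSum, sum_rectWindow_eq']
  have h1 : ∀ c ∈ Finset.range a, ∀ r ∈ Finset.range b,
      diagBondWeight (rectWindow a b) (rectBondWeights w) (mkSite2 c r) 1 =
        if c + 1 < a ∧ 1 ≤ r then w c r 1 else 0 := by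
    intro c hc r hr
    have hc' := Finset.mem_range.1 hc
    have hr' := Finset.mem_range.1 hr
    have hiff : mkSite2 c r + diagVec 1 ∈ rectWindow a b ↔ c + 1 < a ∧ 1 ≤ r := by
      rw [mem_rectWindow']
      simp only [Pi.add_apply, diagVec_apply_zero, diagVec_apply_one, one_ne_zero, if_false, mkSite2_zero',
        mkSite2_one']
      omega
    simp only [diagBondWeight, rectBondWeights, mkSite2_zero', mkSite2_one', Int.toNat_natCast]
    by_cases h : c + 1 < a ∧ 1 ≤ r
    · rw [if_pos (hiff.2 h), if_pos h]
    · rw [if_neg (fun h' => h (hiff.1 h')), if_neg h]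
  rw [Finset.sum_congr rfl fun c hc => Finset.sum_congr rfl fun r hr => h1 c hc r hr]
  rw [← sum_range_ite_succ_lt' a (fun c => ∑ r ∈ Finset.range (b - 1), w c (r + 1) 1)]
  refine Finset.sum_congr rfl fun c _ => ?_
  rw [← sum_range_ite_one_le b (fun r => w c r 1)]
  by_cases hc : c + 1 < a
  · rw [if_pos hc]
    exact Finset.sum_congr rfl fun r _ => by by_cases hr : 1 ≤ r <;> simp [hc, hr]
  · rw [if_neg hc]
    exact Finset.sum_eq_zero fun r _ => by simp [hc]

/-- **EDGE, rectangles in coordinates** (`a` columns `c`, `b` rows `r`; nearest-neighbour bond table `w c r i`, DIAGONAL bond table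
`w' c r s` — type `0` = the bond `(c, r) → (c+1, r+1)`, type `1` = the bond `(c, r) → (c+1, r-1)`, both indexed by the left endpoint —
interaction table `v c r`, potential table `p c r`). -/
theorem energyDensityTT'_ge_of_clusterRect (t t' : ℝ) {U : ℝ} (hU : 0 ≤ U) {n : ℝ} (hn0 : 0 ≤ n) (hn2 : n < 2) (a b : ℕ)
    (w w' : ℕ → ℕ → Fin 2 → ℝ) (v p : ℕ → ℕ → ℝ) {m : ℝ}
    (hw0 : ∑ c ∈ Finset.range (a - 1), ∑ r ∈ Finset.range b, w c r 0 = 1)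
    (hw1 : ∑ c ∈ Finset.range a, ∑ r ∈ Finset.range (b - 1), w c r 1 = 1)
    (hw'0 : ∑ c ∈ Finset.range (a - 1), ∑ r ∈ Finset.range (b - 1), w' c r 0 = 1)
    (hw'1 : ∑ c ∈ Finset.range (a - 1), ∑ r ∈ Finset.range (b - 1), w' c (r + 1) 1 = 1)
    (hv : ∑ c ∈ Finset.range a, ∑ r ∈ Finset.range b, v c r = 1)
    (hm : (clusterHamiltonianTT' (rectWindow a b) t t' U (rectBondWeights w) (rectBondWeights w') (rectSiteWeights v)
      (rectSiteWeights p) - ((m : ℝ) : ℂ) • (1 : FermionOp (rectWindow a b))).PosSemidef) :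
    m - (∑ c ∈ Finset.range a, ∑ r ∈ Finset.range b, p c r) * n ≤ energyDensityTT' t t' U n := by
  rw [← siteWeightSum_rect' a b p]
  exact energyDensityTT'_ge_of_cluster t t' hU hn0 hn2 (rectWindow a b) (rectBondWeights w) (rectBondWeights w')
    (rectSiteWeights v) (rectSiteWeights p)
    (Fin.forall_fin_two.2 ⟨by rw [bondWeightSum_rect_zero']; exact hw0, by rw [bondWeightSum_rect_one']; exact hw1⟩)
    (Fin.forall_fin_two.2 ⟨by rw [diagBondWeightSum_rect_zero]; exact hw'0, by rw [diagBondWeightSum_rect_one]; exact hw'1⟩)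
    (by rw [siteWeightSum_rect']; exact hv) hm

/-! ## §4  The seven-parameter `D₄ × spin`-symmetric `t–t'` class on the open `3 × 3` window -/

/-- `D₄`-symmetric DIAGONAL bond table of the open `3 × 3` window: the four diagonal bonds through the centre `(1,1)`
(type `0`: left endpoint on the main diagonal `c = r`; type `1`: left endpoint on the anti-diagonal `c + r = 2`) carry `jd`, the four
edge-midpoint–edge-midpoint diagonal bonds carry `je`.  Normalisation per type: `2 jd + 2 je = 1`. -/
def d3 (jd je : ℝ) : ℕ → ℕ → Fin 2 → ℝ := fun c r s => if (s = 0 ∧ c = r) ∨ (s = 1 ∧ c + r = 2) then jd else je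

/-- Type-`0` diagonal weight sum of `d3`: `2 jd + 2 je`. -/
theorem sum_d3_zero (jd je : ℝ) :
    ∑ c ∈ Finset.range (3 - 1), ∑ r ∈ Finset.range (3 - 1), d3 jd je c r 0 = 2 * jd + 2 * je := by
  simp [Finset.sum_range_succ, d3]; ring

/-- Type-`1` diagonal weight sum of `d3`: `2 jd + 2 je`. -/
theorem sum_d3_one (jd je : ℝ) :
    ∑ c ∈ Finset.range (3 - 1), ∑ r ∈ Finset.range (3 - 1), d3 jd je c (r + 1) 1 = 2 * jd + 2 * je := by
  simp [Finset.sum_range_succ, d3]; ring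

/-- **The seven-parameter operator** `h₃₃^{tt'}(t, t', U; jb, jc; jd, je; vc, ve, vm; pc, pe, pm)`: the `t–t'` weighted open `3 × 3`
cluster (`clusterHamiltonianTT'`) with g4's `D₄` tables `w3` (nearest-neighbour bonds), `s3` (interaction weights and potentials) and
the diagonal table `d3`. -/
def h33TT' (t t' U jb jc jd je vc ve vm pc pe pm : ℝ) : FermionOp (rectWindow 3 3) :=
  clusterHamiltonianTT' (rectWindow 3 3) t t' U (rectBondWeights (w3 jb jc)) (rectBondWeights (d3 jd je))
    (rectSiteWeights (s3 vc ve vm)) (rectSiteWeights (s3 pc pe pm))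

/-- **The certificate's claim shape** at `t' ≠ 0`: `h₃₃^{tt'} - m·1 ⪰ 0` on the `4⁹`-dimensional cluster Fock space (ONE explicit Hermitian
matrix, block-diagonal in `(N↑, N↓)`: 100 sectors, largest `15 876`). -/
def SdaD4Floor33TT' (t t' U jb jc jd je vc ve vm pc pe pm m : ℝ) : Prop :=
  (h33TT' t t' U jb jc jd je vc ve vm pc pe pm - ((m : ℝ) : ℂ) • (1 : FermionOp (rectWindow 3 3))).PosSemidef

/-- **The seven-parameter class ⇒ thermodynamic-limit floor (PROVED; all `t, t'`, `U ≥ 0`, `0 ≤ n < 2`).** -/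
theorem energyDensityTT'_ge_of_sdaD4Floor33TT' (t t' : ℝ) {U : ℝ} (hU : 0 ≤ U) {n : ℝ} (hn0 : 0 ≤ n) (hn2 : n < 2)
    {jb jc jd je vc ve vm pc pe pm m : ℝ} (hJ : 4 * jb + 2 * jc = 1) (hJ' : 2 * jd + 2 * je = 1)
    (hV : 4 * vc + 4 * ve + vm = 1) (hm : SdaD4Floor33TT' t t' U jb jc jd je vc ve vm pc pe pm m) :
    m - (4 * pc + 4 * pe + pm) * n ≤ energyDensityTT' t t' U n := by
  rw [← sum_s3 pc pe pm]
  exact energyDensityTT'_ge_of_clusterRect t t' hU hn0 hn2 3 3 (w3 jb jc) (d3 jd je) (s3 vc ve vm) (s3 pc pe pm)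
    (by rw [sum_w3_zero]; exact hJ) (by rw [sum_w3_one]; exact hJ) (by rw [sum_d3_zero]; exact hJ')
    (by rw [sum_d3_one]; exact hJ') (by rw [sum_s3]; exact hV) hm

/-- **Cell M3 at any `t'`** (`(t, U, n) = (1, 8, 7/8)`, the venture predicate `M3EnergyLowerRow t' lo`, Statement.lean §M3): a certified
seven-parameter floor books the rational slot `lo` as soon as `lo ≤ m - (4pc + 4pe + pm)·7/8`. -/
theorem m3EnergyLowerRow_of_sdaD4Floor33TT' (t' : ℝ) {jb jc jd je vc ve vm pc pe pm m : ℝ} (hJ : 4 * jb + 2 * jc = 1)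
    (hJ' : 2 * jd + 2 * je = 1) (hV : 4 * vc + 4 * ve + vm = 1) (hm : SdaD4Floor33TT' 1 t' 8 jb jc jd je vc ve vm pc pe pm m)
    {lo : ℚ} (hlo : ((lo : ℚ) : ℝ) ≤ m - (4 * pc + 4 * pe + pm) * (7 / 8)) : M3EnergyLowerRow t' lo :=
  le_trans hlo (energyDensityTT'_ge_of_sdaD4Floor33TT' 1 t' (by norm_num) (by norm_num) (by norm_num) hJ hJ' hV hm)

/-! ## §5  The FROZEN-WEIGHT family at `t' ≠ 0`: g4's `(8, 7/8)` optimum `(w33, v33)` + UNIFORM diagonal weights -/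

/-- With the nearest-neighbour and interaction weights frozen at g4's `(U, n, t') = (8, 7/8, 0)` optimum (`Jb, Jc, Vc, Ve, Vm`,
`SdaClusterWitness.lean` §3) and UNIFORM diagonal weights `jd = je = 1/4`, ANY `t, t'`, `U ≥ 0`, `0 ≤ n < 2`, any three potentials
and any certified floor `m` give `m - (4pc + 4pe + pm)·n ≤ e(t, t', U, n)` — a new `(t', U, n)` point costs a three-number fit and ONE
PSD certificate (the sda13 token `TA` at `JOB_TP ≠ 0` is exactly this sub-class: uniform diagonal representative, free NN / density
transfers). -/
theorem energyDensityTT'_ge_frozen33 (t t' : ℝ) {U : ℝ} (hU : 0 ≤ U) {n : ℝ} (hn0 : 0 ≤ n) (hn2 : n < 2) (pc pe pm m : ℝ)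
    (hm : SdaD4Floor33TT' t t' U Jb Jc (1 / 4) (1 / 4) Vc Ve Vm pc pe pm m) :
    m - (4 * pc + 4 * pe + pm) * n ≤ energyDensityTT' t t' U n :=
  energyDensityTT'_ge_of_sdaD4Floor33TT' t t' hU hn0 hn2 Jb_Jc_sum (by norm_num) Vc_Ve_Vm_sum hm

end Summit.Ventures.CertifiedManyBodySolver.HubbardAlg.SdaClusterWitnessTT
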